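import Mathlib

/-!
# SoloBlind kernel #202 — the outgoing band-centre flux state of the streak chain

Leading order of the LEMMA R datum (architecture A5, PLAN §109 (m)–(n), CLAIMS SB-C1095).
In the fast clock the streak cos-chain (sites `m ≥ 0`, hopping matrix `H1` with the `√2`
first bond: `(H1 ψ)₀ = √2 ψ₁`, `(H1 ψ)₁ = √2 ψ₀ + ψ₂`, `(H1 ψ)ₘ = ψₘ₋₁ + ψₘ₊₁` for `m ≥ 2`)
is driven at the band centre by the local source `w = -α (√2 e₀ - e₂)`, `α = hₓ / h`.
The frame `V` of the loop kernel is, at leading order, the OUTGOING solution of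
`H1 ψ = w`:
  `ψ₀ = -√2 α i`, `ψ₁ = -α`, `ψₘ = -2 α i (-i)^m (m ≥ 2)`.
We record: (1) it solves the driven chain equations site by site; (2) it is outgoing —
`ψₘ₊₁ = (-i) ψₘ` for `m ≥ 2` (phase winding `-π/2` per site, the band-centre
quasi-momentum, as measured: D82); (3) its amplitudes `|ψ₀|² = 2α²`, `|ψ₁|² = α²`,
`|ψₘ|² = 4α²` (the measured 2.39 / 1.69 / 3.39 at `|α| = 1.684`); (4) uniqueness: a
solution of the homogeneous equations that is outgoing from site 2 on vanishes, so the
flux state is the unique outgoing solution.  Pure algebra over `ℂ`.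
-/

namespace Summit.AnomalousDissipation.AnomalousDissipation.Theorems

open Complex

/-- The outgoing band-centre flux state of the streak cos-chain driven by the source
`-α(√2 e₀ - e₂)`: `ψ₀ = -√2 α i`, `ψ₁ = -α`, `ψₘ = -2 α i (-i)^m` for `m ≥ 2`. -/
noncomputable def fluxState (α : ℝ) (m : ℕ) : ℂ :=
  if m = 0 then -(Real.sqrt 2 : ℂ) * α * I
  else if m = 1 then -(α : ℂ)
  else -2 * (α : ℂ) * I * (-I) ^ m

/-- Site 0 of the driven chain equation: `(H1 ψ)₀ = √2 ψ₁ = -√2 α` (the `e₀` component of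
the source `-α(√2 e₀ - e₂)`). -/
theorem fluxState_eq0 (α : ℝ) :
    (Real.sqrt 2 : ℂ) * fluxState α 1 = -(Real.sqrt 2 : ℂ) * α := by
  simp [fluxState]

/-- Site 1: `(H1 ψ)₁ = √2 ψ₀ + ψ₂ = 0` (the source has no `e₁` component at leading order). -/
theorem fluxState_eq1 (α : ℝ) :
    (Real.sqrt 2 : ℂ) * fluxState α 0 + fluxState α 2 = 0 := by
  have h2 : ((Real.sqrt 2 : ℝ) : ℂ) * ((Real.sqrt 2 : ℝ) : ℂ) = 2 := by
    rw [← Complex.ofReal_mul, Real.mul_self_sqrt (by norm_num : (0:ℝ) ≤ 2)]; norm_num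
  simp only [fluxState]
  simp
  ring_nf
  have h2' : ((Real.sqrt 2 : ℝ) : ℂ) ^ 2 = 2 := by rw [pow_two]; exact h2
  rw [h2']
  ring

/-- Site 2: `(H1 ψ)₂ = ψ₁ + ψ₃ = α` (the `-e₂` component of the source, with the sign of
`-α(√2 e₀ - e₂)`). -/
theorem fluxState_eq2 (α : ℝ) : fluxState α 1 + fluxState α 3 = (α : ℂ) := by
  simp only [fluxState]
  simp
  ring_nf
  have h4 : I ^ 4 = 1 := Complex.I_pow_four
  rw [h4]
  ring

/-- Sites `m ≥ 3`: the homogeneous chain equation `ψₘ₋₁ + ψₘ₊₁ = 0`. -/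
theorem fluxState_eq_far (α : ℝ) (m : ℕ) (hm : 3 ≤ m) :
    fluxState α (m - 1) + fluxState α (m + 1) = 0 := by
  have h0 : m - 1 ≠ 0 := by omega
  have h1 : m - 1 ≠ 1 := by omega
  have h0' : m + 1 ≠ 0 := by omega
  have h1' : m + 1 ≠ 1 := by omega
  simp only [fluxState, h0, h1, h0', h1', if_false]
  have hm' : m + 1 = (m - 1) + 2 := by omega
  rw [hm', pow_add]
  have : (-I) ^ 2 = -1 := by rw [neg_sq, Complex.I_sq]
  rw [this]
  ring

/-- OUTGOING: from site 2 on the flux state is a pure outgoing wave at the band-centre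
quasi-momentum, `ψₘ₊₁ = (-i) ψₘ` (phase winding `-π/2` per site). -/
theorem fluxState_outgoing (α : ℝ) (m : ℕ) (hm : 2 ≤ m) :
    fluxState α (m + 1) = (-I) * fluxState α m := by
  have h0 : m ≠ 0 := by omega
  have h1 : m ≠ 1 := by omega
  have h0' : m + 1 ≠ 0 := by omega
  have h1' : m + 1 ≠ 1 := by omega
  simp only [fluxState, h0, h1, h0', h1', if_false]
  rw [pow_succ]
  ring

/-- Amplitudes: `|ψ₀|² = 2 α²`. -/
theorem fluxState_normSq_zero (α : ℝ) : Complex.normSq (fluxState α 0) = 2 * α ^ 2 := by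
  simp only [fluxState, if_true]
  rw [Complex.normSq_mul, Complex.normSq_mul, Complex.normSq_I]
  simp only [Complex.normSq_neg, Complex.normSq_ofReal]
  rw [Real.mul_self_sqrt (by norm_num : (0:ℝ) ≤ 2)]
  ring

/-- Amplitudes: `|ψ₁|² = α²`. -/
theorem fluxState_normSq_one (α : ℝ) : Complex.normSq (fluxState α 1) = α ^ 2 := by
  simp only [fluxState]
  simp [Complex.normSq_neg, Complex.normSq_ofReal, pow_two]

/-- Amplitudes on the radiating plateau: `|ψₘ|² = 4 α²` for `m ≥ 2` (the P-free plateau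
`A = 2|α|` of the frame; measured `A / |α| = 2.00–2.04`). -/
theorem fluxState_normSq_plateau (α : ℝ) (m : ℕ) (hm : 2 ≤ m) :
    Complex.normSq (fluxState α m) = 4 * α ^ 2 := by
  have h0 : m ≠ 0 := by omega
  have h1 : m ≠ 1 := by omega
  simp only [fluxState, h0, h1, if_false]
  rw [Complex.normSq_mul, Complex.normSq_mul, Complex.normSq_mul, map_pow]
  simp only [Complex.normSq_neg, Complex.normSq_I, one_pow, Complex.normSq_ofReal, mul_one]
  norm_num [Complex.normSq_apply]
  ring

/-- UNIQUENESS of the outgoing solution: if `φ` solves the HOMOGENEOUS chain equations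
(`√2 φ₁ = 0`, `√2 φ₀ + φ₂ = 0`, `φₘ₋₁ + φₘ₊₁ = 0` for `m ≥ 2`) and is outgoing from site 2
on (`φₘ₊₁ = (-i) φₘ`, `m ≥ 2`), then `φ = 0`.  Hence the flux state is the unique outgoing
solution of the driven band-centre problem (the standing homogeneous solution
`φ_{2k} = (-1)^k φ₀ · const`, `φ_odd = 0` is excluded by the radiation condition). -/
theorem outgoing_homogeneous_eq_zero (φ : ℕ → ℂ)
    (h0 : (Real.sqrt 2 : ℂ) * φ 1 = 0)
    (h1 : (Real.sqrt 2 : ℂ) * φ 0 + φ 2 = 0)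
    (hfar : ∀ m, 2 ≤ m → φ (m - 1) + φ (m + 1) = 0)
    (hout : ∀ m, 2 ≤ m → φ (m + 1) = (-I) * φ m) :
    ∀ m, φ m = 0 := by
  have hs : (Real.sqrt 2 : ℂ) ≠ 0 := by
    exact_mod_cast (Real.sqrt_pos.mpr (by norm_num : (0:ℝ) < 2)).ne'
  have e1 : φ 1 = 0 := by
    rcases mul_eq_zero.mp h0 with h | h
    · exact absurd h hs
    · exact h
  -- φ 3 = -φ 1 = 0 from the site-2 equation, and φ 3 = (-i) φ 2 from outgoing ⇒ φ 2 = 0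
  have e3 : φ 3 = 0 := by
    have := hfar 2 (le_refl 2)
    simp at this
    rw [e1] at this; simpa using this
  have e2 : φ 2 = 0 := by
    have h := hout 2 (le_refl 2)
    rw [e3] at h
    have hI : (-I : ℂ) ≠ 0 := neg_ne_zero.mpr Complex.I_ne_zero
    rcases mul_eq_zero.mp h.symm with h' | h'
    · exact absurd h' hI
    · exact h'
  have e0 : φ 0 = 0 := by
    rw [e2, add_zero] at h1
    rcases mul_eq_zero.mp h1 with h | h
    · exact absurd h hs
    · exact h
  -- induction upward from site 2 using the outgoing recursion
  have up : ∀ k, φ (k + 2) = 0 := by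
    intro k
    induction k with
    | zero => simpa using e2
    | succ k ih =>
      have h := hout (k + 2) (by omega)
      have : k + 1 + 2 = k + 2 + 1 := by omega
      rw [this, h, ih, mul_zero]
  intro m
  match m with
  | 0 => exact e0
  | 1 => exact e1
  | (k + 2) => exact up k

end Summit.AnomalousDissipation.AnomalousDissipation.Theorems
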